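import Mathlib
import HarnessLib
import Literature.Algebra.EuclideanLattices.IntegerKernelSpan

/-!
# Fermat cycles — the mod-`p` → `ℚ` transfer principle behind the exact certificates

HONEST FRAMING: explicit algebraic cycles for specific Hodge classes on Fermat/Delsarte varieties;
residual open instances listed; no claim on general Hodge.

This file formalises the one non-computational step of the certificates of `ALBANESE.md` §5.11(c)
(residue (A): `1 ∈ I_all`) and §5.11″ ((C1)): **if the reductions modulo a prime `p` of the rows of
an integer matrix span `𝔽_pⁿ`, then the rows span `ℚⁿ`** (rank over `ℚ` ≥ rank modulo `p`).  In the
certificates the rows are the coefficient vectors (in a fixed degree `d₀`) of monomial multiples of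
the homogenised exact members, and "span `𝔽_pⁿ`" is what the mod-`p` leading-monomial count shows.

* `mulVec_eq_zero_only_zero_rat_of_zmod` — injectivity form: if `A̅ y = 0 ⇒ y = 0` over `ZMod p`
  then `A v = 0 ⇒ v = 0` over `ℚ` (clear denominators, divide out the largest power of `p`, reduce);
* `span_rows_eq_top_rat_of_zmod` — the span form used by the certificates.

Everything is proved (no named fact, no `sorry`).
-/

namespace Summit.HodgeConjecture.HodgeConjecture.FermatCycles.ModpTransfer

open Matrix Finset

variable {m n : Type*} [Fintype n]

/-- A non-zero integer vector is `p^k • y` with some coordinate of `y` prime to `p` (`p ≥ 2`). -/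
theorem exists_pow_smul_not_dvd (p : ℕ) (hp : 2 ≤ p) :
    ∀ (N : ℕ) (w : n → ℤ), (∑ j, (w j).natAbs) = N → w ≠ 0 →
      ∃ (k : ℕ) (y : n → ℤ), w = ((p : ℤ) ^ k) • y ∧ ∃ j, ¬ ((p : ℤ) ∣ y j) := by
  intro N
  induction N using Nat.strong_induction_on with
  | _ N ih =>
    intro w hN hw
    by_cases hall : ∀ j, (p : ℤ) ∣ w j
    · choose y' hy' using hall
      have hwy : w = (p : ℤ) • y' := by funext j; simp [hy' j]
      have hy'ne : y' ≠ 0 := by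
        intro h; apply hw; rw [hwy, h]; simp
      -- the absolute sum strictly decreases
      have hsum : (∑ j, (w j).natAbs) = p * ∑ j, (y' j).natAbs := by
        rw [Finset.mul_sum]; refine Finset.sum_congr rfl fun j _ => ?_
        rw [hy' j, Int.natAbs_mul]; simp
      have hpos : 0 < ∑ j, (y' j).natAbs := by
        by_contra h0
        push Not at h0
        have h0' : ∑ j, (y' j).natAbs = 0 := Nat.le_zero.mp h0
        apply hy'ne; funext j
        have := (Finset.sum_eq_zero_iff.mp h0') j (Finset.mem_univ j)
        simpa using this
      have hlt : (∑ j, (y' j).natAbs) < N := by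
        rw [← hN, hsum]
        have : 1 * ∑ j, (y' j).natAbs < p * ∑ j, (y' j).natAbs :=
          Nat.mul_lt_mul_of_lt_of_le (by omega) le_rfl hpos
        simpa using this
      obtain ⟨k, y, hy, j, hj⟩ := ih _ hlt y' rfl hy'ne
      refine ⟨k + 1, y, ?_, j, hj⟩
      rw [hwy, hy, smul_smul, pow_succ, mul_comm]
    · push Not at hall
      obtain ⟨j, hj⟩ := hall
      exact ⟨0, w, by simp, j, hj⟩

/-- **Injectivity form of the transfer.**  If `A̅ *ᵥ y = 0` forces `y = 0` over `ZMod p`, then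
`A *ᵥ v = 0` forces `v = 0` over `ℚ`. -/
theorem mulVec_eq_zero_only_zero_rat_of_zmod (A : Matrix m n ℤ) (p : ℕ) [hp : Fact p.Prime]
    (h : ∀ y : n → ZMod p, (A.map (Int.castRingHom (ZMod p))) *ᵥ y = 0 → y = 0)
    (v : n → ℚ) (hv : (A.map (Int.cast : ℤ → ℚ)) *ᵥ v = 0) : v = 0 := by
  classical
  by_contra hvne
  obtain ⟨d, w, hd, hAw, hwv⟩ :=
    Literature.Algebra.EuclideanLattices.IntegerKernelBasis.exists_int_mul_eq_of_rat A v hv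
  have hwne : w ≠ 0 := by
    intro hw0
    apply hvne; funext j
    have hj := hwv j
    rw [hw0] at hj
    simp only [Pi.zero_apply, Int.cast_zero] at hj
    have hdq : (d : ℚ) ≠ 0 := by exact_mod_cast hd.ne'
    have := mul_eq_zero.mp hj.symm
    rcases this with h1 | h1
    · exact absurd h1 hdq
    · simpa using h1
  obtain ⟨k, y, hwy, j, hj⟩ :=
    exists_pow_smul_not_dvd (n := n) p hp.out.two_le _ w rfl hwne
  -- `A y = 0` over `ℤ` (torsion-free)
  have hAy : A *ᵥ y = 0 := by
    have h1 : ((p : ℤ) ^ k) • (A *ᵥ y) = 0 := by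
      rw [← Matrix.mulVec_smul, ← hwy, hAw]
    have hpk : ((p : ℤ) ^ k) ≠ 0 := pow_ne_zero _ (by exact_mod_cast hp.out.ne_zero)
    exact (smul_eq_zero.mp h1).resolve_left hpk
  -- reduce modulo `p`
  have hAy' : (A.map (Int.castRingHom (ZMod p))) *ᵥ (fun j => ((y j : ℤ) : ZMod p)) = 0 := by
    funext i
    have hi : (((A *ᵥ y) i : ℤ) : ZMod p) = 0 := by rw [congrFun hAy i]; simp
    rw [Pi.zero_apply, ← hi]
    simp only [Matrix.mulVec, dotProduct, Matrix.map_apply, eq_intCast, Int.cast_sum, Int.cast_mul]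
  have hy0 := congrFun (h _ hAy') j
  simp only [Pi.zero_apply] at hy0
  exact hj ((ZMod.intCast_zmod_eq_zero_iff_dvd (y j) p).mp hy0)

/-- Rows spanning everything force `A̅ *ᵥ y = 0 ⇒ y = 0` (any field / commutative ring). -/
theorem mulVec_eq_zero_only_zero_of_span_rows {R : Type*} [CommRing R] (B : Matrix m n R)
    (hspan : Submodule.span R (Set.range fun i => B i) = ⊤) (y : n → R) (hy : B *ᵥ y = 0) :
    y = 0 := by
  classical
  -- the vectors orthogonal to `y` form a submodule containing every row, hence everything
  let S : Submodule R (n → R) :=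
    { carrier := {x | x ⬝ᵥ y = 0}
      add_mem' := by intro a b ha hb; simp only [Set.mem_setOf_eq] at *; rw [add_dotProduct, ha, hb, add_zero]
      zero_mem' := by simp
      smul_mem' := by intro c x hx; simp only [Set.mem_setOf_eq] at *; rw [smul_dotProduct, hx, smul_zero] }
  have hrows : Set.range (fun i => B i) ⊆ (S : Set (n → R)) := by
    rintro _ ⟨i, rfl⟩
    exact congrFun hy i
  have hS : (⊤ : Submodule R (n → R)) ≤ S := by rw [← hspan]; exact Submodule.span_le.mpr hrows
  funext j
  have hj : (Pi.single j (1 : R)) ⬝ᵥ y = 0 := hS Submodule.mem_top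
  simpa using hj

/-- **Span form of the transfer (the statement used by the certificates).**  If the reductions
modulo a prime `p` of the rows of an integer matrix span `(ZMod p)ⁿ`, then the rows span `ℚⁿ`. -/
theorem span_rows_eq_top_rat_of_zmod (A : Matrix m n ℤ) (p : ℕ) [hp : Fact p.Prime]
    (hspan : Submodule.span (ZMod p) (Set.range fun i => (A.map (Int.castRingHom (ZMod p))) i) = ⊤) :
    Submodule.span ℚ (Set.range fun i => (A.map (Int.cast : ℤ → ℚ)) i) = ⊤ := by
  classical
  by_contra hne
  obtain ⟨φ, hφ0, hle⟩ := Submodule.exists_le_ker_of_lt_top _ (lt_top_iff_ne_top.2 hne)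
  -- the coefficient vector of `φ`
  let c : n → ℚ := fun j => φ (Pi.single j 1)
  have hφc : ∀ x : n → ℚ, φ x = x ⬝ᵥ c := by
    intro x
    rw [LinearMap.pi_apply_eq_sum_univ φ x]
    simp only [dotProduct, smul_eq_mul, c]
    refine Finset.sum_congr rfl fun i _ => ?_
    congr 1
    congr 1
    funext j
    simp [Pi.single_apply, eq_comm]
  -- every row is killed by `φ`, i.e. `A_ℚ *ᵥ c = 0`
  have hAc : (A.map (Int.cast : ℤ → ℚ)) *ᵥ c = 0 := by
    funext i
    have hi : φ ((A.map (Int.cast : ℤ → ℚ)) i) = 0 := by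
      have hmem : (A.map (Int.cast : ℤ → ℚ)) i ∈ Submodule.span ℚ (Set.range fun i => (A.map (Int.cast : ℤ → ℚ)) i) :=
        Submodule.subset_span ⟨i, rfl⟩
      exact LinearMap.mem_ker.mp (hle hmem)
    rw [hφc] at hi
    exact hi
  have hinj := mulVec_eq_zero_only_zero_rat_of_zmod A p
    (mulVec_eq_zero_only_zero_of_span_rows _ hspan) c hAc
  apply hφ0
  apply LinearMap.ext
  intro x
  rw [hφc x, hinj]
  simp

end Summit.HodgeConjecture.HodgeConjecture.FermatCycles.ModpTransfer
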